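import Literature.NumberTheory.EllipticCurves.Rubin1991.TwoVariableMainConjecture
import Summits.BirchSwinnertonDyer.BirchSwinnertonDyer.Theorems.PrintCf2RubinValueTwoLinePinExponentPinGeneral
import Literature.NumberTheory.IwasawaTheory.IwasawaAlgebraTwoVarRegularProofs
import HarnessLib

/-!
# Line `m_line_pin_class` (LEAD bsd-line-cf2-p1) for the DECIDING class door `MainConjClauseAtSplitTwoQuadDAClass` (stmt-BirchSwinnertonDyer-23300),
# CLOSING FILE 1/5: the `e = 0` LINE PIN (ramified `θ_K` at `v̄`, trivial analytic Euler factor)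

Cell `bsd-print-cf2`, LEAD seat `bsd-line-cf2-p1` g16, `--supports stmt-BirchSwinnertonDyer-23300 --as helper`. This is §2 of the registered skeleton
`Cruxes/MainConjClauseAtSplitTwoQuadDA/Lines/m_line_pin_class.lean` (v3.0 sha16 b9d7a45020533a18) landed as a Theses-free Theorems module so that the closing
composition (files 2–5) can import it: the twins of cf2c-w8 g4's `e = 1` pin (`LinePin.eq_and_span_eq_of_span_C_mul_eq`,
`LinePin.eq_and_map_charIdeal_eq_span_of_powForm`, `…LinePinExponentPinGeneral`) for the case where the analytic side carries NO Euler factor at `v̄`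
(`θ_K` ramified at `v̄`): then the algebraic exponent `c` is `0` and the `p`-power exponents agree. THEOREMS ONLY (no `def`, no named fact, no `sorry`).
HONEST FRAMING: pure commutative algebra in `𝒪⟦T⟧` / `Λ₂`; nothing about an elliptic curve; BSD is not proved by any of this.
References: [Washington1997] §13.2 (shape of the argument); [deShalit1987] II.4.12 (the Euler factor at `v̄`).
-/

set_option autoImplicit false
set_option linter.dupNamespace false -- D-0017: `…BirchSwinnertonDyer.BirchSwinnertonDyer…` repeats a namespace by design

noncomputable section

open scoped Classical
open NumberField IsDedekindDomain Field WeierstrassCurve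
open Literature.NumberTheory.GaloisRepresentations Literature.NumberTheory.EllipticCurves
open Literature.NumberTheory.EllipticCurves.Rank1Residual
open Literature.NumberTheory.EllipticCurves.DeShalit1987
open Literature.NumberTheory.EllipticCurves.GreenbergVatsal2000
open Summit.BirchSwinnertonDyer.BirchSwinnertonDyer.Theorems
open Summit.BirchSwinnertonDyer.BirchSwinnertonDyer.Theorems.PrintCf2.LinePin
open IntermediateField Literature.NumberTheory.GaloisRepresentations.LocalWeilDatum
open Summit.BirchSwinnertonDyer.BirchSwinnertonDyer.Theorems.PrintCf2
open Literature.NumberTheory Literature.NumberTheory.NumberFields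
open Literature.NumberTheory.EllipticCurves.ZpExtension Literature.NumberTheory.EllipticCurves.KellerYin2024

namespace Summit.BirchSwinnertonDyer.BirchSwinnertonDyer.Theorems.PrintCf2RubinValueTwo.MLinePinClassClose

/-! ## §2. The `e = 0` pin (ramified `θ_K` at `v̄`): kernel-checked twins of cf2c-w8 g4's `e = 1` pin -/

section Pin

variable {𝒪 : Type*} [CommRing 𝒪] [IsDomain 𝒪]

-- `eq_zero_of_associated_C_mul_X_add_C_pow` (the `e = 0` Euler-exponent pin) is the tree's `LinePin.eq_zero_of_associated_C_mul_X_add_C_pow`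
-- (`…LinePinExponentPinGeneral`, p-general); it is used below through `open … LinePin`.

/-- **The abstract line pin with free exponent, TRIVIAL Euler factor on the analytic side.** In `𝒪⟦T⟧` (`𝒪` a domain), `E = T + e₀` (`e₀` a
non-unit), `k₂ ≠ 0`: `(k₁ f) = (k₂ g)`, `(f) = (E)^m · (G₁)`, `(g) = (G₁)`, `G₁ ≠ 0` ⟹ `m = 0`, `(f) = (g)` and `f ≠ 0`. [folklore] -/
theorem eq_zero_and_span_eq_of_span_C_mul_eq_of_unit {e₀ k₁ k₂ : 𝒪} (he₀ : ¬ IsUnit e₀) (hk₂ : k₂ ≠ 0)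
    {f g G₁ : PowerSeries 𝒪} (hG₁ : G₁ ≠ 0) {m : ℕ}
    (hk : Ideal.span ({PowerSeries.C k₁ * f} : Set (PowerSeries 𝒪)) = Ideal.span {PowerSeries.C k₂ * g})
    (hf : Ideal.span ({f} : Set (PowerSeries 𝒪)) = Ideal.span {PowerSeries.X + PowerSeries.C e₀} ^ m * Ideal.span {G₁})
    (hg : Ideal.span ({g} : Set (PowerSeries 𝒪)) = Ideal.span {G₁}) :
    m = 0 ∧ Ideal.span ({f} : Set (PowerSeries 𝒪)) = Ideal.span {g} ∧ f ≠ 0 := by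
  rw [Ideal.span_singleton_pow, Ideal.span_singleton_mul_span_singleton] at hf
  have hfa : Associated f ((PowerSeries.X + PowerSeries.C e₀) ^ m * G₁) := Ideal.span_singleton_eq_span_singleton.mp hf
  have hga : Associated g G₁ := Ideal.span_singleton_eq_span_singleton.mp hg
  have hka : Associated (PowerSeries.C k₁ * f) (PowerSeries.C k₂ * g) := Ideal.span_singleton_eq_span_singleton.mp hk
  -- `k₁ E^m G₁ ~ k₂ G₁`
  have h1 : Associated (PowerSeries.C k₁ * (PowerSeries.X + PowerSeries.C e₀) ^ m * G₁) (PowerSeries.C k₂ * G₁) := by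
    rw [mul_assoc]
    exact ((hfa.mul_left (PowerSeries.C k₁)).symm.trans hka).trans (hga.mul_left (PowerSeries.C k₂))
  have h2 : Associated (PowerSeries.C k₁ * (PowerSeries.X + PowerSeries.C e₀) ^ m) (PowerSeries.C k₂) := by
    have h1' : Associated (PowerSeries.C k₁ * (PowerSeries.X + PowerSeries.C e₀) ^ m * G₁) (PowerSeries.C k₂ * 1 * G₁) := by
      rwa [mul_one]
    have := Associated.of_mul_right h1' (Associated.refl G₁) hG₁
    rwa [mul_one] at this
  have hm : m = 0 := eq_zero_of_associated_C_mul_X_add_C_pow he₀ hk₂ h2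
  subst hm
  rw [pow_zero, one_mul] at hf hfa
  refine ⟨rfl, by rw [hf, hg], ?_⟩
  rw [hfa.ne_zero_iff]
  exact hG₁

end Pin

section PinSocket

universe u

variable {K : Type u} [Field K] [NumberField K] {p : ℕ} [Fact p.Prime] {κ₁ κ₂ : ZpExtension K p}
  {M : Type u} [AddCommGroup M] [DistribMulAction (absoluteGaloisGroup K) M] [TopologicalSpace M] [DiscreteTopology M]
  {vbar : HeightOneSpectrum (𝓞 K)} {γ₁ γ₂ : absoluteGaloisGroup K}

/-- **THE LINE PIN WITH FREE EULER EXPONENT, RAMIFIED CLASS (socket currency)** — the twin of cf2c-w8 g4's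
`LinePin.eq_one_and_map_charIdeal_eq_span_of_powForm` when the analytic Euler factor at `v̄` is `1` (`θ_K` ramified at `v̄`): `D` a two-variable
dual datum with `ch_{Λ₂} D.X = (F)`; (Q) `(p^a · F^J) = (p^b · G₂)`; (X) `π(ch_{Λ₂} D.X) = ((1+T) − u)^c · I₁` with `p ∣ u − 1`, `c` FREE; (M)
`I₁^J = (G₁)`, `G₁ ≠ 0`; (A) `(G₂(T₁,0)) = (G₁)` ⟹ **`c = 0`, `a = b`, `(ch_{Λ₂} D.X).map (map (map J)) = (G₂)`**.
[cite: Washington1997, §13.2 (shape only)] [cite: deShalit1987, II.4.12] -/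
theorem map_charIdeal_eq_span_of_powForm_of_ramified (D : DualData₂ κ₁ κ₂ M vbar γ₁ γ₂)
    (J : ℤ_[p] →+* PadicComplexInt p) (G₂ : PowerSeries (PowerSeries (PadicComplexInt p)))
    (F : IwasawaAlgebra₂ p) (hF : Module.charIdeal (IwasawaAlgebra₂ p) D.X = Ideal.span {F})
    {a b : ℕ} (hQ : Ideal.span ({((p : ℕ) : PowerSeries (PowerSeries (PadicComplexInt p))) ^ a *
        PowerSeries.map (PowerSeries.map J) F} : Set (PowerSeries (PowerSeries (PadicComplexInt p)))) =
      Ideal.span {((p : ℕ) : PowerSeries (PowerSeries (PadicComplexInt p))) ^ b * G₂})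
    {u : ℤ} (hpu : (p : ℤ) ∣ u - 1) {c : ℕ} {I₁ : Ideal (IwasawaAlgebra p)}
    (hC : (Module.charIdeal (IwasawaAlgebra₂ p) D.X).map (PowerSeries.map (PowerSeries.constantCoeff (R := ℤ_[p]))) =
      Ideal.span {((1 : IwasawaAlgebra p) + PowerSeries.X) - (u : IwasawaAlgebra p)} ^ c * I₁)
    (G₁ : PowerSeries (PadicComplexInt p)) (hG₁ : G₁ ≠ 0) (hM : I₁.map (PowerSeries.map J) = Ideal.span {G₁})
    (hA : Ideal.span ({PowerSeries.map (PowerSeries.constantCoeff (R := PadicComplexInt p)) G₂} : Set (PowerSeries (PadicComplexInt p))) =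
      Ideal.span {G₁}) :
    c = 0 ∧ a = b ∧ (Module.charIdeal (IwasawaAlgebra₂ p) D.X).map (PowerSeries.map (PowerSeries.map J)) = Ideal.span {G₂} := by
  have hp0 : ((p : ℕ) : PadicComplexInt p) ≠ 0 := natCast_prime_padicComplexInt_ne_zero (p := p)
  -- (Q) on the line
  have hk := span_C_pow_mul_line_eq_of_powForm J G₂ F hQ
  -- (X)∘(M) on the line, after `J`
  have hf : Ideal.span ({PowerSeries.map J (PowerSeries.map (PowerSeries.constantCoeff (R := ℤ_[p])) F)} :
        Set (PowerSeries (PadicComplexInt p))) =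
      Ideal.span {PowerSeries.X + PowerSeries.C ((1 : PadicComplexInt p) - (u : PadicComplexInt p))} ^ c * Ideal.span {G₁} := by
    have h := congrArg (Ideal.map (PowerSeries.map J)) hC
    rw [hF, map_span_singleton, map_span_singleton, Ideal.map_mul, Ideal.map_pow, map_span_singleton, hM, map_sub, map_add,
      map_one, PowerSeries.map_X, map_intCast, one_add_X_sub_intCast_eq] at h
    exact h
  obtain ⟨hc, hline, hf0⟩ := eq_zero_and_span_eq_of_span_C_mul_eq_of_unit (not_isUnit_one_sub_intCast_padicComplexInt hpu)
    (pow_ne_zero b hp0) hG₁ hk hf hA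
  obtain ⟨hab, h⟩ := map_charIdeal_eq_span_of_powForm_of_firstLine D J G₂ F hF hQ hline hf0
  exact ⟨hc, hab, h⟩

end PinSocket

end Summit.BirchSwinnertonDyer.BirchSwinnertonDyer.Theorems.PrintCf2RubinValueTwo.MLinePinClassClose

end
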